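import Literature.AlgebraicGeometry.Resolution.CentreBlowupOrdAlongBasics
import HarnessLib

/-!
# [OURS · res-dim4-pi PR-9c, part 1a] Hironaka's constrained polyhedra game on lattice positions —
  the game, forcing, and Spivakovsky's theorem as a NAMED HYPOTHESIS

Cell `res-dim4-pi` (D-0157 DOOR 2, wave 2), brick **PR-9c** (seat `res-dim4-p-10`, «width 10»; desk WORD #22 /
#23 (b): the SPINE regime F4-S of the frame).  The desk's spine game (`PurelyInseparableDim4SpineGame`:
`SpinePos`, `SpinePermissible`, `pureMove`, `SpineWon`) is, read on supports, Hironaka's CONSTRAINED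
polyhedra game on finite sets of lattice points `A ⊂ ℕ^σ` with threshold `t` (= the printed game on the
rational points `a / t` with threshold `1`):

* player A chooses a non-empty `J` with `t ≤ Σ_{i∈J} aᵢ` for every `a ∈ A` (PERMISSIBLE,
  [cite: Spivakovsky1983, §I (permissible Γ: Σ_{j∈Γ} x_j ≥ 1)]);
* player B chooses `j ∈ J`; every point moves by `a_j ↦ Σ_{i∈J} aᵢ − t` (the tree's
  `CentreBlowup.chartExponent t J j`, [cite: HauserPerlega2019PRIMS, §2 (the blowup in the x₁-chart)]);
* STRICT win (the typed `SpineWon`: the chart origin is no longer `t`-fold): some point has `Σ aᵢ < t`;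
  WEAK win (Spivakovsky's printed game: «A wins if … Δ⁽ˡ⁾ contains a point with Σ xⱼ ≤ 1»,
  [cite: Spivakovsky1983, §I p. 421]): some point has `Σ aᵢ ≤ t`.  The two thresholds DIFFER; the gap is
  closed in part 1b (`PurelyInseparableDim4PolyhedraBoundary`).

Everything is played in a set `I` of ACTIVE coordinates (`J ⊆ I`, degrees `degIn I`); the other coordinates
ride along unchanged (this is what makes the induction on dimension of part 1b run inside one index type).
«Player A can force reaching `W` from `P`» is the inductive predicate `Forces` (a well-founded game tree —
«guaranteed to win in a finite number of moves, regardless of the responses of B»,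
[cite: Spivakovsky1983, §I (winning strategy)]).  Contents: §1 the game, `Forces`, the named hypothesis
`PolyhedraGame.WeakWin σ I` (Spivakovsky's theorem in the coordinates `I`; used only as a hypothesis, never
asserted), `Forces.weaken`; §2 `degIn` bookkeeping under the chart law and under rescaling.

[OURS · counted 0 · elementary · AI work weaker than expert review] A combinatorial game; NOTHING here proves
resolution of singularities in dimension ≥ 4 / characteristic `p`.
bears_on: LADDER-RESOLUTION:D157-DOOR2 (res-dim4-pi · PR-9c). Supports stmt-ResolutionOfSingularities-16155
(helper).
-/

set_option linter.dupNamespace false -- mandated namespace of this single-conjunct summit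

noncomputable section

namespace Summit.ResolutionOfSingularities.ResolutionOfSingularities.Theorems.PIDim4

namespace PolyhedraGame

open Finset
open Literature.AlgebraicGeometry.Resolution
open Literature.AlgebraicGeometry.Resolution.CentreBlowup

variable {σ : Type} [DecidableEq σ]

/-! ## §1 The game -/

/-- A position: a finite set of lattice points (the support of `F`). [cite: Spivakovsky1983, §I] -/
abbrev Pos (σ : Type) : Type := Finset (σ →₀ ℕ)

/-- `J` is PERMISSIBLE at `P` for the threshold `t`: `J ≠ ∅` and `t ≤ Σ_{i∈J} aᵢ` for all `a ∈ P`.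
[cite: Spivakovsky1983, §I (permissible Γ)] -/
def Permissible (t : ℕ) (J : Finset σ) (P : Pos σ) : Prop :=
  J.Nonempty ∧ ∀ a ∈ P, t ≤ degIn J a

/-- The move `(J, j)`: every point `a` goes to `chartExponent t J j a` (`a_j ↦ Σ_{i∈J} aᵢ − t`).
[cite: Spivakovsky1983, §I (the transformation σ_{Γ,i})] -/
def move (t : ℕ) (J : Finset σ) (j : σ) (P : Pos σ) : Pos σ :=
  P.image (chartExponent t J j)

/-- STRICT win in the active coordinates `I`: the position is empty or some point has `Σ_{i∈I} aᵢ < t`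
(the typed `SpineWon`). [folklore] -/
def StrictWon (t : ℕ) (I : Finset σ) (P : Pos σ) : Prop :=
  P = ∅ ∨ ∃ a ∈ P, degIn I a < t

/-- WEAK win in the active coordinates `I`: empty or some point has `Σ_{i∈I} aᵢ ≤ t` (Spivakovsky's
printed end of the game, «Σ xⱼ ≤ 1»). [cite: Spivakovsky1983, §I p. 421] -/
def WeakWon (t : ℕ) (I : Finset σ) (P : Pos σ) : Prop :=
  P = ∅ ∨ ∃ a ∈ P, degIn I a ≤ t

/-- «Player A can FORCE reaching `W`» playing in the active coordinates `I` with threshold `t`: either `W`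
holds, or some permissible `J ⊆ I` leads into forcing positions whatever `j ∈ J` player B answers.
(The well-founded game tree of a winning strategy.) [cite: Spivakovsky1983, §I (winning strategy)] -/
inductive Forces (W : Pos σ → Prop) (t : ℕ) (I : Finset σ) : Pos σ → Prop
  | won {P : Pos σ} : W P → Forces W t I P
  | step {P : Pos σ} (J : Finset σ) : J ⊆ I → Permissible t J P →
      (∀ j ∈ J, Forces W t I (move t J j P)) → Forces W t I P

/-- **NAMED HYPOTHESIS — Spivakovsky's theorem** («There exists a winning strategy of A for any given Δ»)
for Hironaka's original polyhedra game, in the coordinates `I`, on lattice positions with threshold `t`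
(divide by `t` to get the printed rational game with threshold `1`): from EVERY position player A forces
the WEAK win.  Used only as a hypothesis `(h : WeakWin σ I)`; not proved in this tree.
[cite: Spivakovsky1983, Theorem p. 421 (§I)] -/
def WeakWin (σ : Type) [DecidableEq σ] (I : Finset σ) : Prop :=
  ∀ t : ℕ, 0 < t → ∀ P : Pos σ, Forces (WeakWon t I) t I P

/-- Forcing composes: forcing `W`, and forcing `W'` from every `W`-position, forces `W'`. [folklore] -/
theorem Forces.weaken {W W' : Pos σ → Prop} {t : ℕ} {I : Finset σ} {P : Pos σ}
    (h : Forces W t I P) (hW : ∀ Q, W Q → Forces W' t I Q) : Forces W' t I P := by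
  induction h with
  | won hP => exact hW _ hP
  | step J hJ hperm _ ih => exact Forces.step J hJ hperm ih

/-- A strictly won position is forced (trivially). [folklore] -/
theorem forces_of_strictWon {t : ℕ} {I : Finset σ} {P : Pos σ} (h : StrictWon t I P) :
    Forces (StrictWon t I) t I P :=
  Forces.won h

/-! ## §2 Bookkeeping: `degIn` under the chart law and under rescaling -/

/-- `Σ_{i∈I} a'ᵢ + a_j = Σ_{i∈I} aᵢ + v` for `a' = a` with `a_j` replaced by `v`, `j ∈ I`. [folklore] -/
theorem degIn_update_add {I : Finset σ} {j : σ} (hj : j ∈ I) (a : σ →₀ ℕ) (v : ℕ) :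
    degIn I (a.update j v) + a j = degIn I a + v := by
  unfold degIn
  rw [Finsupp.coe_update, Finset.sum_update_of_mem hj, Finset.sdiff_singleton_eq_erase,
    ← Finset.add_sum_erase I (fun i => a i) hj]
  ring

/-- Replacing a coordinate outside `I` does not change `Σ_{i∈I} aᵢ`. [folklore] -/
theorem degIn_update_of_not_mem {I : Finset σ} {j : σ} (hj : j ∉ I) (a : σ →₀ ℕ) (v : ℕ) :
    degIn I (a.update j v) = degIn I a := by
  unfold degIn
  refine Finset.sum_congr rfl fun i hi => ?_
  have hij : i ≠ j := fun h => hj (h ▸ hi)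
  rw [Finsupp.update_apply, if_neg hij]

/-- The chart law off the active chart variable leaves `degIn I` unchanged (`j ∉ I`). [folklore] -/
theorem degIn_chartExponent_of_not_mem {I J : Finset σ} {j : σ} (hj : j ∉ I) (t : ℕ) (a : σ →₀ ℕ) :
    degIn I (chartExponent t J j a) = degIn I a :=
  degIn_update_of_not_mem hj a _

/-- The chart law at `j ∈ I`: `Σ_I a' + a_j = Σ_I a + (Σ_J a − t)`. [folklore] -/
theorem degIn_chartExponent_add {I J : Finset σ} {j : σ} (hj : j ∈ I) (t : ℕ) (a : σ →₀ ℕ) :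
    degIn I (chartExponent t J j a) + a j = degIn I a + (degIn J a - t) :=
  degIn_update_add hj a _

/-- A point of active degree exactly `t` along a permissible `J ⊆ I`: its `J`-degree is `t` and it has no
mass in `I ∖ J`. [folklore] -/
theorem degIn_eq_and_apply_eq_zero_of_minimal {I J : Finset σ} (hJI : J ⊆ I) {t : ℕ} {a : σ →₀ ℕ}
    (ha : degIn I a = t) (hJa : t ≤ degIn J a) :
    degIn J a = t ∧ ∀ i ∈ I, i ∉ J → a i = 0 := by
  have hsplit : degIn (I \ J) a + degIn J a = degIn I a := by
    unfold degIn; exact Finset.sum_sdiff hJI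
  have hJle : degIn J a ≤ degIn I a := degIn_mono hJI a
  refine ⟨by omega, fun i hi hiJ => ?_⟩
  have hzero : degIn (I \ J) a = 0 := by omega
  exact degIn_eq_zero_iff.mp hzero i (Finset.mem_sdiff.mpr ⟨hi, hiJ⟩)

/-- Rescaling a point and the chart law: with `c * r = L`, `r ≤ Σ_Γ b` and `Σ_J b − t = Σ_Γ b − r`,
`c • (chartExponent t J j b) = chartExponent L Γ j (c • b)`. [folklore] -/
theorem smul_chartExponent_eq {t L c r : ℕ} {J Γ : Finset σ} {j : σ} {b : σ →₀ ℕ}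
    (hcr : c * r = L) (hsub : degIn J b - t = degIn Γ b - r) :
    c • chartExponent t J j b = chartExponent L Γ j (c • b) := by
  symm
  rw [chartExponent_eq_iff]
  refine ⟨?_, fun i hi => ?_⟩
  · rw [Finsupp.smul_apply, chartExponent_apply_self, degIn_nsmul, hsub, ← hcr, smul_eq_mul, mul_tsub]
  · rw [Finsupp.smul_apply, Finsupp.smul_apply, chartExponent_apply_of_ne t J hi]

end PolyhedraGame

end Summit.ResolutionOfSingularities.ResolutionOfSingularities.Theorems.PIDim4

end
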